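import Summits.HodgeConjecture.HodgeConjecture.Theorems.F0P3cStCharTSDomGeneralH        -- ★ p849946 (U2-C) part 1 (LH1-p03): `exists_isLeftTransversal_K` (F1-H's `hR₂` for every `b`)
import Summits.HodgeConjecture.HodgeConjecture.Theorems.F0P3cIwahoriDatumU2             -- ★ p849990 (U2-A) (LH6-p05): `dominant_package_two` (model dominance at every H-dominant diagonal)
import Summits.HodgeConjecture.HodgeConjecture.Theorems.F0P3cCMBorelIwahoriDatumU2       -- ★ p849975 (U2-B) (LH4-p02): the package BY SHAPE (bookkeeping clause texts); brings ★ `placeForm_antidiagTwo_eq`, `comap_localNonsplitEquiv_unipotentU₂`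
import Literature.NumberTheory.Automorphic.ValuedFieldValuativeRelBridge                 -- ★ `v_lt_iff_valuation_lt` (`Valued.v` ↔ `ValuativeRel.valuation`)
import HarnessLib

/-!
# F0 · P3c · line LH6 «StCharTS» — road (D), (U2-C) «DOM-GENERAL-H★», PART 2 (the package clauses): the dominance triple `hbN ∕ hbNbar ∕ hbexh` of F1-H at
# EVERY H-dominant torus point `t ∈ T₂` of the transported `U(Φ₂)(L⁺_v)` Iwahori datum, and the packaged `domGeneralH`
# [Casselman1995, Prop. 1.4.3, Prop. 1.4.4; Rogawski1990, §4.4 p. 46, §12.7 L. 12.7.3 (proof) p. 195]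

Cell `pub/hodgecm-mathlib`, crux H413 = `stmt-HodgeConjecture-24833` (lane `--supports … --as helper`), route HCCMUnconditional; seat A-p16 (g34) as extra hands of
road (D) (owner LH6-p04 (g3); block (U2-C) dealt 2026-09-02T06:40:03Z, ruling (G) 06:44:04Z; PART 1 ★ p849946 by LH1-p03 (g2), PART 2 handed back 06:46:58Z and
taken by this seat 06:59Z).  THEOREMS ONLY (no definition, no instance, no notation, no named fact, no `sorry`); ★-only imports.  HONEST LABEL: HC_CM is proved only
modulo the 7 printed citations (2 remaining: hLiu418 = stmt-HodgeConjecture-24832, h413 = stmt-HodgeConjecture-24833) until rung 0 closes; count-neutral plumbing.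

THE MATHEMATICS.  At a finite place `v` of `L⁺` NON-SPLIT in `L` (`w ∣ v`, `c • w = w`), `H₂ = U(Φ₂)(L⁺_v)` with Borel triple `(B₂, T₂, N₂) = cmBorelTriple L 2 v` and
one-place model `U′ = U(σ_w, Φ₂)(L_w)` along `E₂ = localNonsplitEquiv` ([PlatonovRapinchuk1994, §5.1]).  The (U2-B) package ★ `exists_cmIwahoriDatum₂_of_model` transports
ANY model Iwahori datum `𝓘′` to a datum `𝓘` of `cmBorelTriple L 2 v` and RECORDS `𝓘.K n = K′_n.comap E₂`, `𝓘.Nbar = N̄′.comap E₂`; the (U2-A) model ★ `dominant_package_two`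
gives, at the levels `K′_j = K_{γ₀^{j+1}} ∩ U′` and `N̄′ = w₀N′w₀`, the dominance triple at EVERY diagonal `diag(e₀, e₁)` with `|e₀|_w < |e₁|_w` (H-dominant).  Transporting
clause by clause (★ `StructureTransport.comap_conj_mem ∕ comap_inv_conj_mem_inf ∕ comap_exhaustion`, the same three lines as clauses `haN ∕ haNbar ∕ hexh` of ★
`exists_cmIwahoriDatum₂_of_model`, with `t` in place of `𝓘.a`) yields F1-H's binders ★ p849597 `hbN ∕ hbNbar ∕ hbexh` VERBATIM at `b := t` for every H-dominant `t`
— this is ruling (G)'s conjunct 13, delivered OUTSIDE the package (the package being BY SHAPE).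
* §1 **`dominant_triple_of_model`** — BY SHAPE: model dominance of `E₂ t` at (`𝓘′.K n`, `𝓘′.Nbar`) + the two bookkeeping clauses ⇒ `hbN ∧ hbNbar ∧ hbexh` for `𝓘` at `t`.
* §2 **`dominant_triple_of_levels`** — CONCRETE: bookkeeping against the (U2-A) levels `K_{γ₀^{j+1}} ∩ U′` ∕ `w₀N′w₀` (texts of ★ `exists_iwahoriDatumU_two` VERBATIM) and
  `E₂ t = diagonal ![e₀, e₁]`, `Valued.v e₀ < Valued.v e₁` ⇒ the triple (★ `dominant_package_two` + §1); **`conjunct13_of_levels`** — the literal (G) text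
  (`F0/P3c/LH1/LH1-p03/g2/U2-conjunct13-G.txt`); **`domGeneralH_of_levels`** — the triple AND F1-H's `hR₂` (★ part 1 `exists_isLeftTransversal_K`) in one tuple.
* (the `N = 2` Weyl-stability «hKw» `∀ n, ∀ κ ∈ 𝓘.K n, w₀ κ w₀⁻¹ ∈ 𝓘.K n` from the package clauses 6 + 12 is ★ p850013
  `F0P3cStCharTSK0WeylG.weylElt_mul_mul_inv_mem_level_two` ∕ `exists_weylElt_mem_and_forall_mul_mul_inv_mem_two` (LH5-p05 (g2)) — import it, not restated here.)

## References
* [Casselman1995] W. Casselman, *Introduction to the theory of admissible representations of 𝔭-adic reductive groups* (1995 notes), Prop. 1.4.3, Prop. 1.4.4 p. 14, §1.5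
  Lemma 1.5.1 p. 16, §4.1.
* [Rogawski1990] J. D. Rogawski, *Automorphic Representations of Unitary Groups in Three Variables*, Ann. of Math. Stud. 123 (1990): §1.10 p. 9; §4.4 p. 46
  (`H = U(2) × U(1)`); §12.7 Lemma 12.7.3 (proof) p. 195.
* [PlatonovRapinchuk1994] V. Platonov, A. Rapinchuk, *Algebraic Groups and Number Theory* (1994), §5.1 (the one-place model).
* [BruhatTits1972] F. Bruhat, J. Tits, *Groupes réductifs sur un corps local I*, Publ. Math. IHÉS 41 (1972), (4.4.3)–(4.4.4).
-/

set_option autoImplicit false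
-- the mandated namespace has the single-problem summit's repeated segment (`HodgeConjecture.HodgeConjecture`)
set_option linter.dupNamespace false

noncomputable section

open NumberField IsDedekindDomain Topology
open scoped Matrix MatrixGroups Pointwise
open ValuativeRel
open Literature.NumberTheory Literature.NumberTheory.Automorphic Literature.NumberTheory.Automorphic.UnitaryGroup
open Literature.NumberTheory.GaloisRepresentations
open Summit.HodgeConjecture.HodgeConjecture.Cruxes.H413.F0P3cCMLocalNonsplitBorelTransportU2

namespace Summit.HodgeConjecture.HodgeConjecture.Cruxes.H413.F0P3cStCharTSDomGeneralHPkg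

variable (L : Type) [Field L] [NumberField L] [IsCMField L] (v : HeightOneSpectrum (𝓞 ↥(maximalRealSubfield L)))
  (w : PlacesOver L v) (hw : IsCMField.complexConj L • w.1 = w.1)

/-! ## §1 BY SHAPE: model dominance at `E₂ t` + the bookkeeping clauses ⇒ F1-H's `hbN ∧ hbNbar ∧ hbexh` at `t` -/

set_option maxHeartbeats 400000 in
/-- **THE DOMINANCE TRIPLE TRANSPORTED, BY SHAPE.**  Let `𝓘′` be any Iwahori datum of the Borel of the one-place model `U′ = U(σ_w, Φ₂)(L_w)` and `𝓘` a datum of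
`cmBorelTriple L 2 v` with the (U2-B) bookkeeping `𝓘.K n = K′_n.comap E₂` (all `n`) and `𝓘.Nbar = N̄′.comap E₂` (texts of ★ `exists_cmIwahoriDatum₂_of_model` VERBATIM).  If
`E₂ t` satisfies the model dominance triple at level `n` (`(E₂ t)(K′_n ∩ N′)(E₂ t)⁻¹ ⊆ K′_n`, `(E₂ t)⁻¹(K′_n ∩ N̄′)(E₂ t) ⊆ K′_n ∩ N̄′`, `N′` exhausted by the powers of `E₂ t`),
then `t` satisfies F1-H's `hbN ∧ hbNbar ∧ hbexh` for `𝓘` at level `n` (★ p849597 texts VERBATIM at `b := t`; ★ `StructureTransport.comap_conj_mem ∕ comap_inv_conj_mem_inf ∕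
comap_exhaustion`, ★ `comap_localNonsplitEquiv_unipotentU₂`). [cite: Casselman1995, Prop. 1.4.4 p. 14] [cite: PlatonovRapinchuk1994, §5.1] -/
theorem dominant_triple_of_model (𝓘 : (cmBorelTriple L 2 v).IwahoriDatum)
    (𝓘' : (borelTriple (galAdicCompletionMap (L := L) (IsCMField.complexConj L) hw)
      (placeForm (Matrix.of fun i j : Fin 2 => if i.val + j.val + 1 = 2 then (1 : L) else 0) w.1) (placeForm_antidiagTwo_eq L v w)).IwahoriDatum)
    (hK : ∀ n, 𝓘.K n = (𝓘'.K n).comap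
        (localNonsplitEquiv (IsCMField.complexConj L) (Matrix.of fun i j : Fin 2 => if i.val + j.val + 1 = 2 then (1 : L) else 0)
            (IsCMField.complexConj_ne_one L) w hw :
          «local» L (IsCMField.complexConj L) 2 (Matrix.of fun i j : Fin 2 => if i.val + j.val + 1 = 2 then (1 : L) else 0) v →*
            ↥(unitaryGroupOfForm (galAdicCompletionMap (L := L) (IsCMField.complexConj L) hw)
              (placeForm (Matrix.of fun i j : Fin 2 => if i.val + j.val + 1 = 2 then (1 : L) else 0) w.1))))
    (hNbar : 𝓘.Nbar = 𝓘'.Nbar.comap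
        (localNonsplitEquiv (IsCMField.complexConj L) (Matrix.of fun i j : Fin 2 => if i.val + j.val + 1 = 2 then (1 : L) else 0)
            (IsCMField.complexConj_ne_one L) w hw :
          «local» L (IsCMField.complexConj L) 2 (Matrix.of fun i j : Fin 2 => if i.val + j.val + 1 = 2 then (1 : L) else 0) v →*
            ↥(unitaryGroupOfForm (galAdicCompletionMap (L := L) (IsCMField.complexConj L) hw)
              (placeForm (Matrix.of fun i j : Fin 2 => if i.val + j.val + 1 = 2 then (1 : L) else 0) w.1))))
    (n : ℕ) (t : ↥(unitaryGroupOfForm (conjLocal L (IsCMField.complexConj L) v) (cmLocalForm L 2 v)))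
    (htN' : ∀ x ∈ 𝓘'.K n ⊓ (borelTriple (galAdicCompletionMap (L := L) (IsCMField.complexConj L) hw)
        (placeForm (Matrix.of fun i j : Fin 2 => if i.val + j.val + 1 = 2 then (1 : L) else 0) w.1) (placeForm_antidiagTwo_eq L v w)).N,
      (localNonsplitEquiv (IsCMField.complexConj L) (Matrix.of fun i j : Fin 2 => if i.val + j.val + 1 = 2 then (1 : L) else 0)
          (IsCMField.complexConj_ne_one L) w hw t) * x *
        (localNonsplitEquiv (IsCMField.complexConj L) (Matrix.of fun i j : Fin 2 => if i.val + j.val + 1 = 2 then (1 : L) else 0)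
          (IsCMField.complexConj_ne_one L) w hw t)⁻¹ ∈ 𝓘'.K n)
    (htNbar' : ∀ x ∈ 𝓘'.K n ⊓ 𝓘'.Nbar,
      (localNonsplitEquiv (IsCMField.complexConj L) (Matrix.of fun i j : Fin 2 => if i.val + j.val + 1 = 2 then (1 : L) else 0)
          (IsCMField.complexConj_ne_one L) w hw t)⁻¹ * x *
        (localNonsplitEquiv (IsCMField.complexConj L) (Matrix.of fun i j : Fin 2 => if i.val + j.val + 1 = 2 then (1 : L) else 0)
          (IsCMField.complexConj_ne_one L) w hw t) ∈ 𝓘'.K n ⊓ 𝓘'.Nbar)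
    (htexh' : ∀ x ∈ (borelTriple (galAdicCompletionMap (L := L) (IsCMField.complexConj L) hw)
        (placeForm (Matrix.of fun i j : Fin 2 => if i.val + j.val + 1 = 2 then (1 : L) else 0) w.1) (placeForm_antidiagTwo_eq L v w)).N,
      ∃ m : ℕ, ∀ m', m ≤ m' →
        (localNonsplitEquiv (IsCMField.complexConj L) (Matrix.of fun i j : Fin 2 => if i.val + j.val + 1 = 2 then (1 : L) else 0)
            (IsCMField.complexConj_ne_one L) w hw t) ^ m' * x *
          ((localNonsplitEquiv (IsCMField.complexConj L) (Matrix.of fun i j : Fin 2 => if i.val + j.val + 1 = 2 then (1 : L) else 0)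
            (IsCMField.complexConj_ne_one L) w hw t) ^ m')⁻¹ ∈ 𝓘'.K n) :
    (∀ x ∈ 𝓘.K n ⊓ (cmBorelTriple L 2 v).N, t * x * t⁻¹ ∈ 𝓘.K n) ∧
    (∀ x ∈ 𝓘.K n ⊓ 𝓘.Nbar, t⁻¹ * x * t ∈ 𝓘.K n ⊓ 𝓘.Nbar) ∧
    (∀ x ∈ (cmBorelTriple L 2 v).N, ∃ m : ℕ, ∀ m', m ≤ m' → t ^ m' * x * (t ^ m')⁻¹ ∈ 𝓘.K n) := by
  -- abbreviate the model isomorphism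
  set e := localNonsplitEquiv (IsCMField.complexConj L) (Matrix.of fun i j : Fin 2 => if i.val + j.val + 1 = 2 then (1 : L) else 0)
    (IsCMField.complexConj_ne_one L) w hw with he
  have hsymm : e.symm (e t) = t := e.symm_apply_apply _
  have hNe : ((borelTriple (galAdicCompletionMap (L := L) (IsCMField.complexConj L) hw)
      (placeForm (Matrix.of fun i j : Fin 2 => if i.val + j.val + 1 = 2 then (1 : L) else 0) w.1) (placeForm_antidiagTwo_eq L v w)).N).comap
      (e : «local» L (IsCMField.complexConj L) 2 (Matrix.of fun i j : Fin 2 => if i.val + j.val + 1 = 2 then (1 : L) else 0) v →*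
        ↥(unitaryGroupOfForm (galAdicCompletionMap (L := L) (IsCMField.complexConj L) hw)
          (placeForm (Matrix.of fun i j : Fin 2 => if i.val + j.val + 1 = 2 then (1 : L) else 0) w.1))) = (cmBorelTriple L 2 v).N :=
    comap_localNonsplitEquiv_unipotentU₂ L v w hw
  refine ⟨?_, ?_, ?_⟩
  · -- `hbN`
    intro x hx
    rw [hK n, ← hNe] at hx
    have h1 := StructureTransport.comap_conj_mem e htN' x hx
    rw [hsymm] at h1
    rw [hK n]
    exact h1
  · -- `hbNbar`
    intro x hx
    rw [hK n, hNbar] at hx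
    have h1 := StructureTransport.comap_inv_conj_mem_inf e htNbar' x hx
    rw [hsymm] at h1
    rw [hK n, hNbar]
    exact h1
  · -- `hbexh`
    intro x hx
    rw [← hNe] at hx
    obtain ⟨m, hm⟩ := StructureTransport.comap_exhaustion e htexh' x hx
    refine ⟨m, fun m' hm' => ?_⟩
    have h1 := hm m' hm'
    rw [hsymm] at h1
    rw [hK n]
    exact h1

/-! ## §2 CONCRETE: the (U2-A) levels `K_{γ₀^{j+1}} ∩ U′`, `N̄′ = w₀N′w₀`, and an H-dominant diagonal `E₂ t = diag(e₀, e₁)`, `|e₀|_w < |e₁|_w` -/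

/-- **THE DOMINANCE TRIPLE AT EVERY H-DOMINANT TORUS POINT (ruling (G)'s conjunct 13, delivered outside the BY-SHAPE package).**  For the model datum `𝓘′` of ★
`exists_iwahoriDatumU_two` ∕ `exists_iwahoriDatumU` (levels `K′_j = K_{γ₀^{j+1}} ∩ U′`, `N̄′ = w₀N′w₀` — its two equations VERBATIM as hypotheses, any `0 ≠ γ₀ < 1`), the
transported datum `𝓘` with the (U2-B) bookkeeping clauses, and ANY `t ∈ U(Φ₂)(L⁺_v)` whose one-place matrix is `diagonal ![e₀, e₁]` with `Valued.v e₀ < Valued.v e₁`: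
F1-H's `hbN ∧ hbNbar ∧ hbexh` hold for `𝓘` at `b := t`, every level `n` (★ (U2-A) `dominant_package_two` + §1; `Valued.v ↔ valuation` by ★ `v_lt_iff_valuation_lt`).
[cite: Casselman1995, Prop. 1.4.3, Prop. 1.4.4 p. 14] [cite: Rogawski1990, §4.4 p. 46; §12.7 L. 12.7.3 (proof) p. 195] [cite: PlatonovRapinchuk1994, §5.1] -/
theorem dominant_triple_of_levels {γ₀ : ValueGroupWithZero (w.1.adicCompletion L)} (hγ₀0 : γ₀ ≠ 0) (hγ₀1 : γ₀ < 1)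
    (𝓘 : (cmBorelTriple L 2 v).IwahoriDatum)
    (𝓘' : (borelTriple (galAdicCompletionMap (L := L) (IsCMField.complexConj L) hw)
      (placeForm (Matrix.of fun i j : Fin 2 => if i.val + j.val + 1 = 2 then (1 : L) else 0) w.1) (placeForm_antidiagTwo_eq L v w)).IwahoriDatum)
    (hNbar' : 𝓘'.Nbar = ((borelTriple (galAdicCompletionMap (L := L) (IsCMField.complexConj L) hw)
      (placeForm (Matrix.of fun i j : Fin 2 => if i.val + j.val + 1 = 2 then (1 : L) else 0) w.1) (placeForm_antidiagTwo_eq L v w)).N).map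
        (MulAut.conj (weylLongU (galAdicCompletionMap (L := L) (IsCMField.complexConj L) hw) (placeForm_antidiagTwo_eq L v w))).toMonoidHom)
    (hK' : ∀ j : ℕ, 𝓘'.K j = (congruenceGL 2 (γ₀ ^ (j + 1))).comap (unitaryGroupOfForm (galAdicCompletionMap (L := L) (IsCMField.complexConj L) hw)
      (placeForm (Matrix.of fun i j : Fin 2 => if i.val + j.val + 1 = 2 then (1 : L) else 0) w.1)).subtype)
    (hK : ∀ n, 𝓘.K n = (𝓘'.K n).comap
        (localNonsplitEquiv (IsCMField.complexConj L) (Matrix.of fun i j : Fin 2 => if i.val + j.val + 1 = 2 then (1 : L) else 0)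
            (IsCMField.complexConj_ne_one L) w hw :
          «local» L (IsCMField.complexConj L) 2 (Matrix.of fun i j : Fin 2 => if i.val + j.val + 1 = 2 then (1 : L) else 0) v →*
            ↥(unitaryGroupOfForm (galAdicCompletionMap (L := L) (IsCMField.complexConj L) hw)
              (placeForm (Matrix.of fun i j : Fin 2 => if i.val + j.val + 1 = 2 then (1 : L) else 0) w.1))))
    (hNbar : 𝓘.Nbar = 𝓘'.Nbar.comap
        (localNonsplitEquiv (IsCMField.complexConj L) (Matrix.of fun i j : Fin 2 => if i.val + j.val + 1 = 2 then (1 : L) else 0)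
            (IsCMField.complexConj_ne_one L) w hw :
          «local» L (IsCMField.complexConj L) 2 (Matrix.of fun i j : Fin 2 => if i.val + j.val + 1 = 2 then (1 : L) else 0) v →*
            ↥(unitaryGroupOfForm (galAdicCompletionMap (L := L) (IsCMField.complexConj L) hw)
              (placeForm (Matrix.of fun i j : Fin 2 => if i.val + j.val + 1 = 2 then (1 : L) else 0) w.1))))
    (n : ℕ) (t : ↥(unitaryGroupOfForm (conjLocal L (IsCMField.complexConj L) v) (cmLocalForm L 2 v))) {e₀ e₁ : w.1.adicCompletion L}
    (ht : ((((localNonsplitEquiv (IsCMField.complexConj L) (Matrix.of fun i j : Fin 2 => if i.val + j.val + 1 = 2 then (1 : L) else 0)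
          (IsCMField.complexConj_ne_one L) w hw) t :
        ↥(unitaryGroupOfForm (galAdicCompletionMap (L := L) (IsCMField.complexConj L) hw)
          (placeForm (Matrix.of fun i j : Fin 2 => if i.val + j.val + 1 = 2 then (1 : L) else 0) w.1))) :
        GL (Fin 2) (w.1.adicCompletion L)) : Matrix (Fin 2) (Fin 2) (w.1.adicCompletion L)) = Matrix.diagonal ![e₀, e₁])
    (hlt : Valued.v e₀ < Valued.v e₁) :
    (∀ x ∈ 𝓘.K n ⊓ (cmBorelTriple L 2 v).N, t * x * t⁻¹ ∈ 𝓘.K n) ∧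
    (∀ x ∈ 𝓘.K n ⊓ 𝓘.Nbar, t⁻¹ * x * t ∈ 𝓘.K n ⊓ 𝓘.Nbar) ∧
    (∀ x ∈ (cmBorelTriple L 2 v).N, ∃ m : ℕ, ∀ m', m ≤ m' → t ^ m' * x * (t ^ m')⁻¹ ∈ 𝓘.K n) := by
  have hlt' : valuation (w.1.adicCompletion L) e₀ < valuation (w.1.adicCompletion L) e₁ := (v_lt_iff_valuation_lt e₀ e₁).1 hlt
  have hdom := F0P3cIwahoriDatumU2.dominant_package_two (galAdicCompletionMap (L := L) (IsCMField.complexConj L) hw) (placeForm_antidiagTwo_eq L v w)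
    hγ₀0 hγ₀1 _ ht hlt' n
  refine dominant_triple_of_model L v w hw 𝓘 𝓘' hK hNbar n t ?_ ?_ ?_
  · rw [hK' n]; exact hdom.1
  · rw [hK' n, hNbar']; exact hdom.2.1
  · rw [hK' n]; exact hdom.2.2.1

/-- **RULING (G)'s CONJUNCT 13 — THE LITERAL TEXT** (`F0/P3c/LH1/LH1-p03/g2/U2-conjunct13-G.txt`, LH1-p03 (g2) 06:43:19Z; owner «=» 06:44:04Z) for the transported datum of
the (U2-A) levels: `∀ n, ∀ t ∈ T₂, ∀ e₀ e₁, E₂ t = diagonal ![e₀, e₁] → Valued.v e₀ < Valued.v e₁ → hbN ∧ hbNbar ∧ hbexh`. [cite: Casselman1995, Prop. 1.4.3, Prop. 1.4.4 p. 14]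
[cite: Rogawski1990, §12.7 L. 12.7.3 (proof) p. 195] -/
theorem conjunct13_of_levels {γ₀ : ValueGroupWithZero (w.1.adicCompletion L)} (hγ₀0 : γ₀ ≠ 0) (hγ₀1 : γ₀ < 1)
    (𝓘 : (cmBorelTriple L 2 v).IwahoriDatum)
    (𝓘' : (borelTriple (galAdicCompletionMap (L := L) (IsCMField.complexConj L) hw)
      (placeForm (Matrix.of fun i j : Fin 2 => if i.val + j.val + 1 = 2 then (1 : L) else 0) w.1) (placeForm_antidiagTwo_eq L v w)).IwahoriDatum)
    (hNbar' : 𝓘'.Nbar = ((borelTriple (galAdicCompletionMap (L := L) (IsCMField.complexConj L) hw)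
      (placeForm (Matrix.of fun i j : Fin 2 => if i.val + j.val + 1 = 2 then (1 : L) else 0) w.1) (placeForm_antidiagTwo_eq L v w)).N).map
        (MulAut.conj (weylLongU (galAdicCompletionMap (L := L) (IsCMField.complexConj L) hw) (placeForm_antidiagTwo_eq L v w))).toMonoidHom)
    (hK' : ∀ j : ℕ, 𝓘'.K j = (congruenceGL 2 (γ₀ ^ (j + 1))).comap (unitaryGroupOfForm (galAdicCompletionMap (L := L) (IsCMField.complexConj L) hw)
      (placeForm (Matrix.of fun i j : Fin 2 => if i.val + j.val + 1 = 2 then (1 : L) else 0) w.1)).subtype)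
    (hK : ∀ n, 𝓘.K n = (𝓘'.K n).comap
        (localNonsplitEquiv (IsCMField.complexConj L) (Matrix.of fun i j : Fin 2 => if i.val + j.val + 1 = 2 then (1 : L) else 0)
            (IsCMField.complexConj_ne_one L) w hw :
          «local» L (IsCMField.complexConj L) 2 (Matrix.of fun i j : Fin 2 => if i.val + j.val + 1 = 2 then (1 : L) else 0) v →*
            ↥(unitaryGroupOfForm (galAdicCompletionMap (L := L) (IsCMField.complexConj L) hw)
              (placeForm (Matrix.of fun i j : Fin 2 => if i.val + j.val + 1 = 2 then (1 : L) else 0) w.1))))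
    (hNbar : 𝓘.Nbar = 𝓘'.Nbar.comap
        (localNonsplitEquiv (IsCMField.complexConj L) (Matrix.of fun i j : Fin 2 => if i.val + j.val + 1 = 2 then (1 : L) else 0)
            (IsCMField.complexConj_ne_one L) w hw :
          «local» L (IsCMField.complexConj L) 2 (Matrix.of fun i j : Fin 2 => if i.val + j.val + 1 = 2 then (1 : L) else 0) v →*
            ↥(unitaryGroupOfForm (galAdicCompletionMap (L := L) (IsCMField.complexConj L) hw)
              (placeForm (Matrix.of fun i j : Fin 2 => if i.val + j.val + 1 = 2 then (1 : L) else 0) w.1)))) :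
    ∀ (n : ℕ) (t : ↥(unitaryGroupOfForm (conjLocal L (IsCMField.complexConj L) v) (cmLocalForm L 2 v))), t ∈ (cmBorelTriple L 2 v).M →
      ∀ (e₀ e₁ : w.1.adicCompletion L),
        ((((localNonsplitEquiv (IsCMField.complexConj L) (Matrix.of fun i j : Fin 2 => if i.val + j.val + 1 = 2 then (1 : L) else 0)
              (IsCMField.complexConj_ne_one L) w hw) t :
            ↥(unitaryGroupOfForm (galAdicCompletionMap (L := L) (IsCMField.complexConj L) hw)
              (placeForm (Matrix.of fun i j : Fin 2 => if i.val + j.val + 1 = 2 then (1 : L) else 0) w.1))) :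
            GL (Fin 2) (w.1.adicCompletion L)) : Matrix (Fin 2) (Fin 2) (w.1.adicCompletion L)) = Matrix.diagonal ![e₀, e₁] →
        Valued.v e₀ < Valued.v e₁ →
        (∀ x ∈ 𝓘.K n ⊓ (cmBorelTriple L 2 v).N, t * x * t⁻¹ ∈ 𝓘.K n) ∧
        (∀ x ∈ 𝓘.K n ⊓ 𝓘.Nbar, t⁻¹ * x * t ∈ 𝓘.K n ⊓ 𝓘.Nbar) ∧
        (∀ x ∈ (cmBorelTriple L 2 v).N, ∃ m : ℕ, ∀ m', m ≤ m' → t ^ m' * x * (t ^ m')⁻¹ ∈ 𝓘.K n) :=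
  fun n t _ _ _ ht hlt => dominant_triple_of_levels L v w hw hγ₀0 hγ₀1 𝓘 𝓘' hNbar' hK' hK hNbar n t ht hlt

/-- **`domGeneralH` — THE (U2-C) TUPLE**: at every H-dominant `t` and every level `n`, F1-H's `hbN`, `hbNbar`, `hbexh` (§2) AND `hR₂` (★ part 1 `exists_isLeftTransversal_K`):
everything ★ `smoothTrace_cmPrincipalSeriesH_indicator_shell_eq_ite` asks of `(𝓘₂, b := t)` besides `hiff`. [cite: Casselman1995, Prop. 1.4.4 p. 14, §4.1]
[cite: Rogawski1990, §12.7 L. 12.7.3 (proof) p. 195] -/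
theorem domGeneralH_of_levels {γ₀ : ValueGroupWithZero (w.1.adicCompletion L)} (hγ₀0 : γ₀ ≠ 0) (hγ₀1 : γ₀ < 1)
    (𝓘 : (cmBorelTriple L 2 v).IwahoriDatum)
    (𝓘' : (borelTriple (galAdicCompletionMap (L := L) (IsCMField.complexConj L) hw)
      (placeForm (Matrix.of fun i j : Fin 2 => if i.val + j.val + 1 = 2 then (1 : L) else 0) w.1) (placeForm_antidiagTwo_eq L v w)).IwahoriDatum)
    (hNbar' : 𝓘'.Nbar = ((borelTriple (galAdicCompletionMap (L := L) (IsCMField.complexConj L) hw)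
      (placeForm (Matrix.of fun i j : Fin 2 => if i.val + j.val + 1 = 2 then (1 : L) else 0) w.1) (placeForm_antidiagTwo_eq L v w)).N).map
        (MulAut.conj (weylLongU (galAdicCompletionMap (L := L) (IsCMField.complexConj L) hw) (placeForm_antidiagTwo_eq L v w))).toMonoidHom)
    (hK' : ∀ j : ℕ, 𝓘'.K j = (congruenceGL 2 (γ₀ ^ (j + 1))).comap (unitaryGroupOfForm (galAdicCompletionMap (L := L) (IsCMField.complexConj L) hw)
      (placeForm (Matrix.of fun i j : Fin 2 => if i.val + j.val + 1 = 2 then (1 : L) else 0) w.1)).subtype)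
    (hK : ∀ n, 𝓘.K n = (𝓘'.K n).comap
        (localNonsplitEquiv (IsCMField.complexConj L) (Matrix.of fun i j : Fin 2 => if i.val + j.val + 1 = 2 then (1 : L) else 0)
            (IsCMField.complexConj_ne_one L) w hw :
          «local» L (IsCMField.complexConj L) 2 (Matrix.of fun i j : Fin 2 => if i.val + j.val + 1 = 2 then (1 : L) else 0) v →*
            ↥(unitaryGroupOfForm (galAdicCompletionMap (L := L) (IsCMField.complexConj L) hw)
              (placeForm (Matrix.of fun i j : Fin 2 => if i.val + j.val + 1 = 2 then (1 : L) else 0) w.1))))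
    (hNbar : 𝓘.Nbar = 𝓘'.Nbar.comap
        (localNonsplitEquiv (IsCMField.complexConj L) (Matrix.of fun i j : Fin 2 => if i.val + j.val + 1 = 2 then (1 : L) else 0)
            (IsCMField.complexConj_ne_one L) w hw :
          «local» L (IsCMField.complexConj L) 2 (Matrix.of fun i j : Fin 2 => if i.val + j.val + 1 = 2 then (1 : L) else 0) v →*
            ↥(unitaryGroupOfForm (galAdicCompletionMap (L := L) (IsCMField.complexConj L) hw)
              (placeForm (Matrix.of fun i j : Fin 2 => if i.val + j.val + 1 = 2 then (1 : L) else 0) w.1))))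
    (n : ℕ) (t : ↥(unitaryGroupOfForm (conjLocal L (IsCMField.complexConj L) v) (cmLocalForm L 2 v))) {e₀ e₁ : w.1.adicCompletion L}
    (ht : ((((localNonsplitEquiv (IsCMField.complexConj L) (Matrix.of fun i j : Fin 2 => if i.val + j.val + 1 = 2 then (1 : L) else 0)
          (IsCMField.complexConj_ne_one L) w hw) t :
        ↥(unitaryGroupOfForm (galAdicCompletionMap (L := L) (IsCMField.complexConj L) hw)
          (placeForm (Matrix.of fun i j : Fin 2 => if i.val + j.val + 1 = 2 then (1 : L) else 0) w.1))) :
        GL (Fin 2) (w.1.adicCompletion L)) : Matrix (Fin 2) (Fin 2) (w.1.adicCompletion L)) = Matrix.diagonal ![e₀, e₁])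
    (hlt : Valued.v e₀ < Valued.v e₁) :
    (∀ x ∈ 𝓘.K n ⊓ (cmBorelTriple L 2 v).N, t * x * t⁻¹ ∈ 𝓘.K n) ∧
    (∀ x ∈ 𝓘.K n ⊓ 𝓘.Nbar, t⁻¹ * x * t ∈ 𝓘.K n ⊓ 𝓘.Nbar) ∧
    (∀ x ∈ (cmBorelTriple L 2 v).N, ∃ m : ℕ, ∀ m', m ≤ m' → t ^ m' * x * (t ^ m')⁻¹ ∈ 𝓘.K n) ∧
    (∃ R₂ : Finset ↥(unitaryGroupOfForm (conjLocal L (IsCMField.complexConj L) v) (cmLocalForm L 2 v)),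
      IsLeftTransversal (𝓘.K n) (𝓘.K n ⊓ ConjAct.toConjAct t • 𝓘.K n) R₂) := by
  obtain ⟨h1, h2, h3⟩ := dominant_triple_of_levels L v w hw hγ₀0 hγ₀1 𝓘 𝓘' hNbar' hK' hK hNbar n t ht hlt
  exact ⟨h1, h2, h3, F0P3cStCharTSDomGeneralH.exists_isLeftTransversal_K L v 𝓘 n t⟩

/-! ## §3 (ED. 2) AGAINST THE INSTANTIATED PACKAGE ★ p850065 `exists_cmIwahoriDatum₂`: its composite bookkeeping clauses `𝓘.K n = (K_{|α|^{n+1}} ∩ U′).comap E₂`,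
`𝓘.Nbar = (w₀N′w₀).comap E₂` (no model datum exposed) ⇒ the triple and `domGeneralH` -/

set_option maxHeartbeats 1600000 in  -- ★ p850065's composite bookkeeping clauses: long defeq unfoldings of `cmLocalForm` vs the one-place model (as ★ U2Inst)
/-- **THE DOMINANCE TRIPLE AT EVERY H-DOMINANT TORUS POINT, AGAINST ★ p850065's CLAUSES** (ED. 2).  For the datum `𝓘` of ★ `F0P3cCMBorelIwahoriDatumU2Inst.exists_cmIwahoriDatum₂`
along the ray `d(α, (σ_w α)⁻¹)` (`α ≠ 0`, `|α|_w < 1`) — whose last two conjuncts are taken here VERBATIM as `hK`, `hNbar` — and ANY `t ∈ U(Φ₂)(L⁺_v)` whose one-place matrix is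
`diagonal ![e₀, e₁]` with `Valued.v e₀ < Valued.v e₁` (H-dominant): F1-H's `hbN ∧ hbNbar ∧ hbexh` (★ p849597 texts VERBATIM at `b := t`), every level `n`
(★ (U2-A) `dominant_package_two` at `γ₀ := |α|_w`, `s := E₂ t`; transport ★ `StructureTransport.comap_*` as in §1). [cite: Casselman1995, Prop. 1.4.3, Prop. 1.4.4 p. 14]
[cite: Rogawski1990, §4.4 p. 46; §12.7 L. 12.7.3 (proof) p. 195] [cite: PlatonovRapinchuk1994, §5.1] -/
theorem dominant_triple_of_inst {α : w.1.adicCompletion L} (hα0 : α ≠ 0) (hα1 : Valued.v α < 1)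
    (𝓘 : (cmBorelTriple L 2 v).IwahoriDatum)
    (hK : ∀ n, 𝓘.K n = ((congruenceGL 2 (valuation (w.1.adicCompletion L) α ^ (n + 1))).comap
          (unitaryGroupOfForm (galAdicCompletionMap (L := L) (IsCMField.complexConj L) hw)
            (placeForm (Matrix.of fun i j : Fin 2 => if i.val + j.val + 1 = 2 then (1 : L) else 0) w.1)).subtype).comap
        (localNonsplitEquiv (IsCMField.complexConj L) (Matrix.of fun i j : Fin 2 => if i.val + j.val + 1 = 2 then (1 : L) else 0)
            (IsCMField.complexConj_ne_one L) w hw :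
          «local» L (IsCMField.complexConj L) 2 (Matrix.of fun i j : Fin 2 => if i.val + j.val + 1 = 2 then (1 : L) else 0) v →*
            ↥(unitaryGroupOfForm (galAdicCompletionMap (L := L) (IsCMField.complexConj L) hw)
              (placeForm (Matrix.of fun i j : Fin 2 => if i.val + j.val + 1 = 2 then (1 : L) else 0) w.1))))
    (hNbar : 𝓘.Nbar = (((borelTriple (galAdicCompletionMap (L := L) (IsCMField.complexConj L) hw)
          (placeForm (Matrix.of fun i j : Fin 2 => if i.val + j.val + 1 = 2 then (1 : L) else 0) w.1) (placeForm_antidiagTwo_eq L v w)).N).map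
          (MulAut.conj (weylLongU (galAdicCompletionMap (L := L) (IsCMField.complexConj L) hw) (placeForm_antidiagTwo_eq L v w))).toMonoidHom).comap
        (localNonsplitEquiv (IsCMField.complexConj L) (Matrix.of fun i j : Fin 2 => if i.val + j.val + 1 = 2 then (1 : L) else 0)
            (IsCMField.complexConj_ne_one L) w hw :
          «local» L (IsCMField.complexConj L) 2 (Matrix.of fun i j : Fin 2 => if i.val + j.val + 1 = 2 then (1 : L) else 0) v →*
            ↥(unitaryGroupOfForm (galAdicCompletionMap (L := L) (IsCMField.complexConj L) hw)
              (placeForm (Matrix.of fun i j : Fin 2 => if i.val + j.val + 1 = 2 then (1 : L) else 0) w.1))))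
    (n : ℕ) (t : ↥(unitaryGroupOfForm (conjLocal L (IsCMField.complexConj L) v) (cmLocalForm L 2 v))) {e₀ e₁ : w.1.adicCompletion L}
    (ht : ((((localNonsplitEquiv (IsCMField.complexConj L) (Matrix.of fun i j : Fin 2 => if i.val + j.val + 1 = 2 then (1 : L) else 0)
          (IsCMField.complexConj_ne_one L) w hw) t :
        ↥(unitaryGroupOfForm (galAdicCompletionMap (L := L) (IsCMField.complexConj L) hw)
          (placeForm (Matrix.of fun i j : Fin 2 => if i.val + j.val + 1 = 2 then (1 : L) else 0) w.1))) :
        GL (Fin 2) (w.1.adicCompletion L)) : Matrix (Fin 2) (Fin 2) (w.1.adicCompletion L)) = Matrix.diagonal ![e₀, e₁])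
    (hlt : Valued.v e₀ < Valued.v e₁) :
    (∀ x ∈ 𝓘.K n ⊓ (cmBorelTriple L 2 v).N, t * x * t⁻¹ ∈ 𝓘.K n) ∧
    (∀ x ∈ 𝓘.K n ⊓ 𝓘.Nbar, t⁻¹ * x * t ∈ 𝓘.K n ⊓ 𝓘.Nbar) ∧
    (∀ x ∈ (cmBorelTriple L 2 v).N, ∃ m : ℕ, ∀ m', m ≤ m' → t ^ m' * x * (t ^ m')⁻¹ ∈ 𝓘.K n) := by
  have hα1' : valuation (w.1.adicCompletion L) α < 1 := (v_lt_one_iff_valuation_lt_one α).1 hα1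
  have hq0 : valuation (w.1.adicCompletion L) α ≠ 0 := (Valuation.ne_zero_iff _).2 hα0
  have hlt' : valuation (w.1.adicCompletion L) e₀ < valuation (w.1.adicCompletion L) e₁ := (v_lt_iff_valuation_lt e₀ e₁).1 hlt
  have hdom := F0P3cIwahoriDatumU2.dominant_package_two (galAdicCompletionMap (L := L) (IsCMField.complexConj L) hw) (placeForm_antidiagTwo_eq L v w)
    hq0 hα1' _ ht hlt' n
  -- abbreviate the model isomorphism
  set e := localNonsplitEquiv (IsCMField.complexConj L) (Matrix.of fun i j : Fin 2 => if i.val + j.val + 1 = 2 then (1 : L) else 0)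
    (IsCMField.complexConj_ne_one L) w hw with he
  have hsymm : e.symm (e t) = t := e.symm_apply_apply _
  have hNe : ((borelTriple (galAdicCompletionMap (L := L) (IsCMField.complexConj L) hw)
      (placeForm (Matrix.of fun i j : Fin 2 => if i.val + j.val + 1 = 2 then (1 : L) else 0) w.1) (placeForm_antidiagTwo_eq L v w)).N).comap
      (e : «local» L (IsCMField.complexConj L) 2 (Matrix.of fun i j : Fin 2 => if i.val + j.val + 1 = 2 then (1 : L) else 0) v →*
        ↥(unitaryGroupOfForm (galAdicCompletionMap (L := L) (IsCMField.complexConj L) hw)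
          (placeForm (Matrix.of fun i j : Fin 2 => if i.val + j.val + 1 = 2 then (1 : L) else 0) w.1))) = (cmBorelTriple L 2 v).N :=
    comap_localNonsplitEquiv_unipotentU₂ L v w hw
  refine ⟨?_, ?_, ?_⟩
  · -- `hbN`
    intro x hx
    rw [hK n, ← hNe] at hx
    have h1 := StructureTransport.comap_conj_mem e hdom.1 x hx
    rw [hsymm] at h1
    rw [hK n]
    exact h1
  · -- `hbNbar`
    intro x hx
    rw [hK n, hNbar] at hx
    have h1 := StructureTransport.comap_inv_conj_mem_inf e hdom.2.1 x hx
    rw [hsymm] at h1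
    rw [hK n, hNbar]
    exact h1
  · -- `hbexh`
    intro x hx
    rw [← hNe] at hx
    obtain ⟨m, hm⟩ := StructureTransport.comap_exhaustion e hdom.2.2.1 x hx
    refine ⟨m, fun m' hm' => ?_⟩
    have h1 := hm m' hm'
    rw [hsymm] at h1
    rw [hK n]
    exact h1

set_option maxHeartbeats 1600000 in  -- ★ p850065's composite bookkeeping clauses: long defeq unfoldings of `cmLocalForm` vs the one-place model (as ★ U2Inst)
/-- **`domGeneralH` AGAINST ★ p850065's CLAUSES** (ED. 2): at every H-dominant `t` and every level `n`, F1-H's `hbN`, `hbNbar`, `hbexh` (previous theorem) AND `hR₂` (★ part 1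
`exists_isLeftTransversal_K`) — the (U2-C) tuple the XIG-ASSEMBLY head passes to ★ F1-H ∕ ② HOH-SHELL-H, with the Inst's bookkeeping clauses as the only datum-specific input.
[cite: Casselman1995, Prop. 1.4.4 p. 14, §4.1] [cite: Rogawski1990, §12.7 L. 12.7.3 (proof) p. 195] -/
theorem domGeneralH_of_inst {α : w.1.adicCompletion L} (hα0 : α ≠ 0) (hα1 : Valued.v α < 1)
    (𝓘 : (cmBorelTriple L 2 v).IwahoriDatum)
    (hK : ∀ n, 𝓘.K n = ((congruenceGL 2 (valuation (w.1.adicCompletion L) α ^ (n + 1))).comap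
          (unitaryGroupOfForm (galAdicCompletionMap (L := L) (IsCMField.complexConj L) hw)
            (placeForm (Matrix.of fun i j : Fin 2 => if i.val + j.val + 1 = 2 then (1 : L) else 0) w.1)).subtype).comap
        (localNonsplitEquiv (IsCMField.complexConj L) (Matrix.of fun i j : Fin 2 => if i.val + j.val + 1 = 2 then (1 : L) else 0)
            (IsCMField.complexConj_ne_one L) w hw :
          «local» L (IsCMField.complexConj L) 2 (Matrix.of fun i j : Fin 2 => if i.val + j.val + 1 = 2 then (1 : L) else 0) v →*
            ↥(unitaryGroupOfForm (galAdicCompletionMap (L := L) (IsCMField.complexConj L) hw)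
              (placeForm (Matrix.of fun i j : Fin 2 => if i.val + j.val + 1 = 2 then (1 : L) else 0) w.1))))
    (hNbar : 𝓘.Nbar = (((borelTriple (galAdicCompletionMap (L := L) (IsCMField.complexConj L) hw)
          (placeForm (Matrix.of fun i j : Fin 2 => if i.val + j.val + 1 = 2 then (1 : L) else 0) w.1) (placeForm_antidiagTwo_eq L v w)).N).map
          (MulAut.conj (weylLongU (galAdicCompletionMap (L := L) (IsCMField.complexConj L) hw) (placeForm_antidiagTwo_eq L v w))).toMonoidHom).comap
        (localNonsplitEquiv (IsCMField.complexConj L) (Matrix.of fun i j : Fin 2 => if i.val + j.val + 1 = 2 then (1 : L) else 0)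
            (IsCMField.complexConj_ne_one L) w hw :
          «local» L (IsCMField.complexConj L) 2 (Matrix.of fun i j : Fin 2 => if i.val + j.val + 1 = 2 then (1 : L) else 0) v →*
            ↥(unitaryGroupOfForm (galAdicCompletionMap (L := L) (IsCMField.complexConj L) hw)
              (placeForm (Matrix.of fun i j : Fin 2 => if i.val + j.val + 1 = 2 then (1 : L) else 0) w.1))))
    (n : ℕ) (t : ↥(unitaryGroupOfForm (conjLocal L (IsCMField.complexConj L) v) (cmLocalForm L 2 v))) {e₀ e₁ : w.1.adicCompletion L}
    (ht : ((((localNonsplitEquiv (IsCMField.complexConj L) (Matrix.of fun i j : Fin 2 => if i.val + j.val + 1 = 2 then (1 : L) else 0)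
          (IsCMField.complexConj_ne_one L) w hw) t :
        ↥(unitaryGroupOfForm (galAdicCompletionMap (L := L) (IsCMField.complexConj L) hw)
          (placeForm (Matrix.of fun i j : Fin 2 => if i.val + j.val + 1 = 2 then (1 : L) else 0) w.1))) :
        GL (Fin 2) (w.1.adicCompletion L)) : Matrix (Fin 2) (Fin 2) (w.1.adicCompletion L)) = Matrix.diagonal ![e₀, e₁])
    (hlt : Valued.v e₀ < Valued.v e₁) :
    (∀ x ∈ 𝓘.K n ⊓ (cmBorelTriple L 2 v).N, t * x * t⁻¹ ∈ 𝓘.K n) ∧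
    (∀ x ∈ 𝓘.K n ⊓ 𝓘.Nbar, t⁻¹ * x * t ∈ 𝓘.K n ⊓ 𝓘.Nbar) ∧
    (∀ x ∈ (cmBorelTriple L 2 v).N, ∃ m : ℕ, ∀ m', m ≤ m' → t ^ m' * x * (t ^ m')⁻¹ ∈ 𝓘.K n) ∧
    (∃ R₂ : Finset ↥(unitaryGroupOfForm (conjLocal L (IsCMField.complexConj L) v) (cmLocalForm L 2 v)),
      IsLeftTransversal (𝓘.K n) (𝓘.K n ⊓ ConjAct.toConjAct t • 𝓘.K n) R₂) := by
  obtain ⟨h1, h2, h3⟩ := dominant_triple_of_inst L v w hw hα0 hα1 𝓘 hK hNbar n t ht hlt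
  exact ⟨h1, h2, h3, F0P3cStCharTSDomGeneralH.exists_isLeftTransversal_K L v 𝓘 n t⟩

end Summit.HodgeConjecture.HodgeConjecture.Cruxes.H413.F0P3cStCharTSDomGeneralHPkg

end
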